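import Summits.FinalStateConjecture.FinalStateConjecture.Theses.LaminatedThreshold
import Literature.Geometry.Lorentzian.HomothetyAdaptedChart
import Literature.Geometry.Lorentzian.IdealPoints
import Literature.Geometry.Lorentzian.LeviCivitaProofs

/-!
# Crux `LaminatedThreshold` — STRATEGY CENSUS sketches (crux-strategist, 2026-08-17)

Typed signatures referred to in `STRATEGY-CENSUS.md` (`## Strengthen`, `## Negation`,
`## Decomposition`), each elaborating against the route file; two of the census claims are
kernel-checked here (`laminated_of_fatLocal`, `not_laminated_of_localExitEverywhere`).
Nothing in this file is a route item or a registered stub.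
-/

noncomputable section

set_option linter.dupNamespace false

namespace Summit.FinalStateConjecture.FinalStateConjecture.Cruxes.LaminatedThreshold.Census

open Set Filter Function Topology TopologicalSpace
open scoped Manifold ContDiff
open Literature.Geometry.Lorentzian
open Summit.FinalStateConjecture.FinalStateConjecture.Theses.LaminatedThreshold

/-! ## Strengthen: S⁺ = FAT exceptional set at `d⋆` (the constant-`Φ` branch of the crux) -/

/-- **S⁺ (FatLocal)**: some admissible datum all of whose small compactly supported jointly smooth
admissible deformations are exceptional. `Φ ≡ 0`, `K = univ` turns it into the crux
(`laminated_of_fatLocal`); it is the crux with the lamination chart removed, i.e. a STABLY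
exceptional datum (a stable naked singularity under local kicks, or a far-field-forced
obstruction) — believed false; no mechanism. [folklore] -/
def FatLocal : Prop :=
  ∃ (X : Type) (_ : TopologicalSpace X) (_ : ChartedSpace Literature.Geometry.Lorentzian.E3 X) (_ : IsManifold (𝓡 3) ((⊤ : ℕ∞) : WithTop ℕ∞) X) (_ : T2Space X) (_ : SecondCountableTopology X) (_ : ConnectedSpace X) (dstar : Literature.Geometry.Lorentzian.InitialDataSet (𝓡 3) X), dstar ∈ Literature.Geometry.Lorentzian.admissibleVacuumData X ∧ ∀ F : EuclideanSpace ℝ (Fin 1) → Literature.Geometry.Lorentzian.InitialDataSet (𝓡 3) X, Literature.Geometry.Lorentzian.InitialDataSet.IsSmoothDataFamily 1 F → F 0 = dstar → (∀ c, F c ∈ Literature.Geometry.Lorentzian.admissibleVacuumData X) → (∃ C : Set X, IsCompact C ∧ ∀ c, ∀ x ∉ C, (F c).h.inner x = dstar.h.inner x ∧ (F c).k x = dstar.k x) → ∃ δ : ℝ, 0 < δ ∧ ∀ c ∈ Metric.ball (0 : EuclideanSpace ℝ (Fin 1)) δ, ¬ ((∃ 𝒟 : Literature.Geometry.Lorentzian.VacuumCauchyDevelopment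 (F c), 𝒟.IsMaximal) ∧ ∀ 𝒟 : Literature.Geometry.Lorentzian.VacuumCauchyDevelopment (F c), 𝒟.IsMaximal → Summit.FinalStateConjecture.HasCompleteNullInfinity 𝒟.toCauchyDevelopment ∧ ∃ (O : Set 𝒟.carrier) (d : Literature.Geometry.Lorentzian.FinalStateDecomposition 𝒟.toSpacetime O 2), (∀ i, Literature.Geometry.Lorentzian.Kerr.IsSubextremal (d.mass i) (d.spin i)) ∧ O = Summit.FinalStateConjecture.exteriorOf 𝒟.toCauchyDevelopment d.charted ∧ Summit.FinalStateConjecture.RaysStayInClosure 𝒟.toCauchyDevelopment O ∧ Summit.FinalStateConjecture.HasExhaustiveCharts d ∧ Summit.FinalStateConjecture.IsFutureOriented d)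

/-- FAT ⇒ crux (the degenerate branch the crux admits by design). [folklore] -/
theorem laminated_of_fatLocal (h : FatLocal) : LaminatedThreshold := by
  obtain ⟨X, i₁, i₂, i₃, i₄, i₅, i₆, dstar, hadm, hfat⟩ := h
  refine ⟨X, i₁, i₂, i₃, i₄, i₅, i₆, dstar, fun _ ↦ 0, Set.univ, hadm, ?_, Set.mem_univ _, ?_, ?_⟩
  · obtain ⟨δ, hδ, hbad⟩ := hfat (fun _ ↦ dstar) (InitialDataSet.isSmoothDataFamily_const 1 dstar)
      rfl (fun _ ↦ hadm) ⟨∅, isCompact_empty, fun _ _ _ ↦ ⟨rfl, rfl⟩⟩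
    exact hbad 0 (Metric.mem_ball_self hδ)
  · intro ε hε
    exact ⟨⟨-(ε / 2), Set.mem_univ _, by constructor <;> linarith⟩,
      ⟨ε / 2, Set.mem_univ _, by constructor <;> linarith⟩⟩
  · intro F hF h0 hFadm hC
    obtain ⟨δ, hδ, hbad⟩ := hfat F hF h0 hFadm hC
    exact ⟨δ, hδ, continuousOn_const, fun c hc _ ↦ hbad c hc⟩

/-- **S⁺⁺ (StableNakedProfile)**, the only typed mechanism for FAT on offer: a nonflat smooth
self-similar vacuum profile with NO smooth non-gauge unstable mode in a homothety-adapted chart of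
its past (a would-be attractor of the renormalised flow; its nonlinear stability would give an open
set of naked data). Contradicted by the blue-shift / trapped-surface-formation heuristics for every
known self-similar collapse model; recorded to show the strengthening was typed, not to be pursued.
[cite: GundlachMartingarcia2007, §2.3] -/
def StableNakedProfile : Prop :=
  ∃ Z : Literature.Geometry.Lorentzian.SelfSimilarVacuumProfile.{0} ((⊤ : ℕ∞) : WithTop ℕ∞), Z.IsNonflat ∧ ∃ (W : Set Z.carrier) (ψ : Z.carrier → Literature.Geometry.Lorentzian.E4), Z.IsHomothetyAdaptedChart W ψ ∧ Z.past ⊆ W ∧ ¬ Z.HasSmoothUnstableModeInChart W ψ 2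

/-! ## Negation: ¬(crux) ⟸ compactly supported exit windows at EVERY exceptional admissible datum -/

/-- **LocalExitEverywhere** (the positive routes' shared hidden lemma, local-kick form): every
admissible exceptional datum is left by a compactly supported jointly smooth admissible family
whose members `0 < ‖c‖ < ε` are good. [cite: Christodoulou1999, p. A24] -/
def LocalExitEverywhere : Prop :=
  ∀ (X : Type) [TopologicalSpace X] [ChartedSpace Literature.Geometry.Lorentzian.E3 X] [IsManifold (𝓡 3) ((⊤ : ℕ∞) : WithTop ℕ∞) X] [T2Space X] [SecondCountableTopology X] [ConnectedSpace X], ∀ dstar ∈ Literature.Geometry.Lorentzian.admissibleVacuumData X, ¬ ((∃ 𝒟 : Literature.Geometry.Lorentzian.VacuumCauchyDevelopment dstar, 𝒟.IsMaximal) ∧ ∀ 𝒟 : Literature.Geometry.Lorentzian.VacuumCauchyDevelopment dstar, 𝒟.IsMaximal → Summit.FinalStateConjecture.HasCompleteNullInfinity 𝒟.toCauchyDevelopment ∧ ∃ (O : Set 𝒟.carrier) (d : Literature.Geometry.Lorentzian.FinalStateDecomposition 𝒟.toSpacetime O 2), (∀ i, Literature.Geometry.Lorentzian.Kerr.IsSubextremal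 (d.mass i) (d.spin i)) ∧ O = Summit.FinalStateConjecture.exteriorOf 𝒟.toCauchyDevelopment d.charted ∧ Summit.FinalStateConjecture.RaysStayInClosure 𝒟.toCauchyDevelopment O ∧ Summit.FinalStateConjecture.HasExhaustiveCharts d ∧ Summit.FinalStateConjecture.IsFutureOriented d) → ∃ F : EuclideanSpace ℝ (Fin 1) → Literature.Geometry.Lorentzian.InitialDataSet (𝓡 3) X, Literature.Geometry.Lorentzian.InitialDataSet.IsSmoothDataFamily 1 F ∧ F 0 = dstar ∧ (∀ c, F c ∈ Literature.Geometry.Lorentzian.admissibleVacuumData X) ∧ (∃ C : Set X, IsCompact C ∧ ∀ c, ∀ x ∉ C, (F c).h.inner x = dstar.h.inner x ∧ (F c).k x = dstar.k x) ∧ ∃ ε : ℝ, 0 < ε ∧ ∀ c, c ≠ 0 → ‖c‖ < ε → ((∃ 𝒟 : Literature.Geometry.Lorentzian.VacuumCauchyDevelopment (F c), 𝒟.IsMaximal) ∧ ∀ 𝒟 : Literature.Geometry.Lorentzian.VacuumCauchyDevelopment (F c), 𝒟.IsMaximal → Summit.FinalStateConjecture.HasCompleteNullInfinity 𝒟.toCauchyDevelopment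 ∧ ∃ (O : Set 𝒟.carrier) (d : Literature.Geometry.Lorentzian.FinalStateDecomposition 𝒟.toSpacetime O 2), (∀ i, Literature.Geometry.Lorentzian.Kerr.IsSubextremal (d.mass i) (d.spin i)) ∧ O = Summit.FinalStateConjecture.exteriorOf 𝒟.toCauchyDevelopment d.charted ∧ Summit.FinalStateConjecture.RaysStayInClosure 𝒟.toCauchyDevelopment O ∧ Summit.FinalStateConjecture.HasExhaustiveCharts d ∧ Summit.FinalStateConjecture.IsFutureOriented d)

/-- **Negation reduces to local curve-genericity**: `LocalExitEverywhere → ¬ LaminatedThreshold`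
(the lamination lemma of `closes`, with the route's crux B replaced by the local exit itself).
[folklore] -/
theorem not_laminated_of_localExitEverywhere (hE : LocalExitEverywhere) : ¬ LaminatedThreshold := by
  rintro ⟨X, i₁, i₂, i₃, i₄, i₅, i₆, dstar, Φ, K, hD, hbad, hk, hacc, hsat⟩
  obtain ⟨F', hF', h0', hadm', hC', ε, hε, hgood⟩ := hE X dstar hD hbad
  obtain ⟨δ, hδ, hcont, hK⟩ := hsat F' hF' h0' hadm' hC'
  set v : EuclideanSpace ℝ (Fin 1) := EuclideanSpace.single (0 : Fin 1) (1 : ℝ) with hv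
  have hnv : ‖v‖ = 1 := by simp [hv]
  have hv0 : v ≠ 0 := by
    intro h; rw [h, norm_zero] at hnv; exact zero_ne_one hnv
  set ρ : ℝ := min δ ε / 2 with hρ
  have hρpos : 0 < ρ := by positivity
  have hρδ : ρ < δ := by
    have : min δ ε ≤ δ := min_le_left _ _
    rw [hρ]; linarith
  have hρε : ρ < ε := by
    have : min δ ε ≤ ε := min_le_right _ _
    rw [hρ]; linarith
  set f : ℝ → ℝ := fun t ↦ Φ (F' (t • v)) with hf
  have hnorm : ∀ t : ℝ, ‖t • v‖ = |t| := fun t ↦ by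
    rw [norm_smul, hnv, mul_one, Real.norm_eq_abs]
  have hnotK : ∀ t ∈ Set.Ioo (0 : ℝ) ρ, f t ∉ K := by
    intro t ht hmem
    have htne : t • v ≠ 0 := smul_ne_zero (ne_of_gt ht.1) hv0
    have hball : t • v ∈ Metric.ball (0 : EuclideanSpace ℝ (Fin 1)) δ := by
      rw [mem_ball_zero_iff, hnorm, abs_of_pos ht.1]; exact ht.2.trans hρδ
    have hlt : ‖t • v‖ < ε := by rw [hnorm, abs_of_pos ht.1]; exact ht.2.trans hρε
    exact hK (t • v) hball hmem (hgood (t • v) htne hlt)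
  have hγ : Continuous fun t : ℝ ↦ t • v := continuous_id.smul continuous_const
  have hmaps : Set.MapsTo (fun t : ℝ ↦ t • v) (Set.Ioo 0 ρ) (Metric.ball 0 δ) := by
    intro t ht
    rw [mem_ball_zero_iff, hnorm, abs_of_pos ht.1]; exact ht.2.trans hρδ
  have hfcont : ContinuousOn f (Set.Ioo 0 ρ) := hcont.comp hγ.continuousOn hmaps
  have hf0 : f 0 = Φ dstar := by simp [hf, h0']
  have hfat : ContinuousAt f 0 := by
    have h1 : ContinuousAt (fun c ↦ Φ (F' c)) 0 :=
      (hcont 0 (Metric.mem_ball_self hδ)).continuousAt (Metric.ball_mem_nhds 0 hδ)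
    have h2 : ContinuousAt (fun t : ℝ ↦ t • v) 0 := hγ.continuousAt
    have h3 := ContinuousAt.comp_of_eq (g := fun c ↦ Φ (F' c)) (f := fun t : ℝ ↦ t • v) h1 h2
      (by simp)
    simpa [hf, Function.comp_def] using h3
  have htend : Tendsto f (𝓝[>] 0) (𝓝 (Φ dstar)) := by
    rw [← hf0]; exact tendsto_nhdsWithin_of_tendsto_nhds hfat
  have hpre : IsPreconnected (f '' Set.Ioo 0 ρ) := isPreconnected_Ioo.image f hfcont
  have hconst : ∀ t₀ ∈ Set.Ioo (0 : ℝ) ρ, f t₀ = Φ dstar := by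
    intro t₀ ht₀
    rcases lt_trichotomy (f t₀) (Φ dstar) with hlt | heq | hgt
    · obtain ⟨k₁, hk₁K, hk₁⟩ := (hacc (Φ dstar - f t₀) (by linarith)).1
      have hk₁lo : f t₀ < k₁ := by have := hk₁.1; linarith
      have hk₁hi : k₁ < Φ dstar := hk₁.2
      have hev : ∀ᶠ t in 𝓝[>] (0 : ℝ), k₁ < f t ∧ t ∈ Set.Ioo 0 ρ :=
        ((tendsto_order.1 htend).1 k₁ hk₁hi).and (Ioo_mem_nhdsGT hρpos)
      obtain ⟨t, hkt, ht⟩ := hev.exists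
      have hsub : Set.Icc (f t₀) (f t) ⊆ f '' Set.Ioo 0 ρ :=
        hpre.Icc_subset (Set.mem_image_of_mem f ht₀) (Set.mem_image_of_mem f ht)
      obtain ⟨t₁, ht₁, hft₁⟩ := hsub ⟨hk₁lo.le, hkt.le⟩
      exact absurd (hft₁ ▸ hk₁K) (hnotK t₁ ht₁)
    · exact heq
    · obtain ⟨k₁, hk₁K, hk₁⟩ := (hacc (f t₀ - Φ dstar) (by linarith)).2
      have hk₁lo : Φ dstar < k₁ := hk₁.1
      have hk₁hi : k₁ < f t₀ := by have := hk₁.2; linarith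
      have hev : ∀ᶠ t in 𝓝[>] (0 : ℝ), f t < k₁ ∧ t ∈ Set.Ioo 0 ρ :=
        ((tendsto_order.1 htend).2 k₁ hk₁lo).and (Ioo_mem_nhdsGT hρpos)
      obtain ⟨t, hkt, ht⟩ := hev.exists
      have hsub : Set.Icc (f t) (f t₀) ⊆ f '' Set.Ioo 0 ρ :=
        hpre.Icc_subset (Set.mem_image_of_mem f ht) (Set.mem_image_of_mem f ht₀)
      obtain ⟨t₁, ht₁, hft₁⟩ := hsub ⟨hkt.le, hk₁hi.le⟩
      exact absurd (hft₁ ▸ hk₁K) (hnotK t₁ ht₁)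
  have hmid : ρ / 2 ∈ Set.Ioo (0 : ℝ) ρ := ⟨by positivity, by linarith⟩
  exact hnotK (ρ / 2) hmid ((hconst (ρ / 2) hmid).symm ▸ hk)

/-! ## Decomposition (rejected alternative): self-similarly naked comb leaves -/

/-- **SelfSimilarlyNakedComb**: the crux's `(Φ, K)`-chart whose `K`-leaves are data every MGHD of
which has a FIRST NAKED POINT carrying a nonflat smooth self-similar `C²` tangent profile (the
vocabulary of the positive tangent-profile cruxes). Rejected as a cut of the crux: a first naked
point already forces incomplete `𝓘⁺` by the landed
`CauchyDevelopment.FirstNakedPoint.not_hasCompleteFutureNullInfinity`, so "leaf ⇒ exceptional" is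
one line and the whole crux would sit in this single stub (shredding); and for a CHAOTIC mechanism
the leaves have no self-similar tangent profile at all. [cite: RodnianskiShlapentokhRothman2023, Def. 1.1] -/
def SelfSimilarlyNakedComb : Prop :=
  ∃ (X : Type) (_ : TopologicalSpace X) (_ : ChartedSpace Literature.Geometry.Lorentzian.E3 X) (_ : IsManifold (𝓡 3) ((⊤ : ℕ∞) : WithTop ℕ∞) X) (_ : T2Space X) (_ : SecondCountableTopology X) (_ : ConnectedSpace X) (dstar : Literature.Geometry.Lorentzian.InitialDataSet (𝓡 3) X) (Φ : Literature.Geometry.Lorentzian.InitialDataSet (𝓡 3) X → ℝ) (K : Set ℝ), dstar ∈ Literature.Geometry.Lorentzian.admissibleVacuumData X ∧ Φ dstar ∈ K ∧ (∀ ε : ℝ, 0 < ε → (K ∩ Set.Ioo (Φ dstar - ε) (Φ dstar)).Nonempty ∧ (K ∩ Set.Ioo (Φ dstar) (Φ dstar + ε)).Nonempty) ∧ ∀ F : EuclideanSpace ℝ (Fin 1) → Literature.Geometry.Lorentzian.InitialDataSet (𝓡 3) X, Literature.Geometry.Lorentzian.InitialDataSet.IsSmoothDataFamily 1 F → F 0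 = dstar → (∀ c, F c ∈ Literature.Geometry.Lorentzian.admissibleVacuumData X) → (∃ C : Set X, IsCompact C ∧ ∀ c, ∀ x ∉ C, (F c).h.inner x = dstar.h.inner x ∧ (F c).k x = dstar.k x) → ∃ δ : ℝ, 0 < δ ∧ ContinuousOn (fun c ↦ Φ (F c)) (Metric.ball 0 δ) ∧ ∀ c ∈ Metric.ball (0 : EuclideanSpace ℝ (Fin 1)) δ, Φ (F c) ∈ K → ∀ 𝒟 : Literature.Geometry.Lorentzian.VacuumCauchyDevelopment (F c), 𝒟.IsMaximal → ∃ P : Set 𝒟.carrier, 𝒟.toCauchyDevelopment.FirstNakedPoint P ∧ ∃ Z : Literature.Geometry.Lorentzian.SelfSimilarVacuumProfile.{0} ((⊤ : ℕ∞) : WithTop ℕ∞), Z.IsNonflat ∧ Literature.Geometry.Lorentzian.Spacetime.IsTangentProfileAt 𝒟.toSpacetime P Z.toSpacetime Z.past 2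

/-- The one-line collapse: a self-similarly naked comb IS a laminated threshold, by the landed
visibility lemma alone (no further stub needed). [folklore] -/
theorem laminated_of_selfSimilarlyNakedComb (h : SelfSimilarlyNakedComb) : LaminatedThreshold := by
  obtain ⟨X, i₁, i₂, i₃, i₄, i₅, i₆, dstar, Φ, K, hadm, hk, hacc, hsat⟩ := h
  -- leaf ⇒ exceptional, in one step
  have key : ∀ D : InitialDataSet (𝓡 3) X,
      (∀ 𝒟 : VacuumCauchyDevelopment D, 𝒟.IsMaximal →
        ∃ P : Set 𝒟.carrier, 𝒟.toCauchyDevelopment.FirstNakedPoint P ∧ ∃ Z : SelfSimilarVacuumProfile.{0} ((⊤ : ℕ∞) : WithTop ℕ∞),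
          Z.IsNonflat ∧ Spacetime.IsTangentProfileAt 𝒟.toSpacetime P Z.toSpacetime Z.past 2) →
      ¬ ((∃ 𝒟 : Literature.Geometry.Lorentzian.VacuumCauchyDevelopment D, 𝒟.IsMaximal) ∧ ∀ 𝒟 : Literature.Geometry.Lorentzian.VacuumCauchyDevelopment D, 𝒟.IsMaximal → Summit.FinalStateConjecture.HasCompleteNullInfinity 𝒟.toCauchyDevelopment ∧ ∃ (O : Set 𝒟.carrier) (d : Literature.Geometry.Lorentzian.FinalStateDecomposition 𝒟.toSpacetime O 2), (∀ i, Literature.Geometry.Lorentzian.Kerr.IsSubextremal (d.mass i) (d.spin i)) ∧ O = Summit.FinalStateConjecture.exteriorOf 𝒟.toCauchyDevelopment d.charted ∧ Summit.FinalStateConjecture.RaysStayInClosure 𝒟.toCauchyDevelopment O ∧ Summit.FinalStateConjecture.HasExhaustiveCharts d ∧ Summit.FinalStateConjecture.IsFutureOriented d) := by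
    rintro D hnaked ⟨⟨𝒟, h𝒟⟩, hgood⟩
    obtain ⟨P, hP, -⟩ := hnaked 𝒟 h𝒟
    obtain ⟨hscri, -⟩ := hgood 𝒟 h𝒟
    haveI : 𝒟.metric.HasLeviCivita := 𝒟.metric.hasLeviCivita
    exact (CauchyDevelopment.FirstNakedPoint.not_hasCompleteFutureNullInfinity hP) hscri
  refine ⟨X, i₁, i₂, i₃, i₄, i₅, i₆, dstar, Φ, K, hadm, ?_, hk, hacc, ?_⟩
  · obtain ⟨δ, hδ, -, hleaf⟩ := hsat (fun _ ↦ dstar) (InitialDataSet.isSmoothDataFamily_const 1 dstar)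
      rfl (fun _ ↦ hadm) ⟨∅, isCompact_empty, fun _ _ _ ↦ ⟨rfl, rfl⟩⟩
    exact key dstar (hleaf 0 (Metric.mem_ball_self hδ) hk)
  · intro F hF h0 hFadm hC
    obtain ⟨δ, hδ, hcont, hleaf⟩ := hsat F hF h0 hFadm hC
    exact ⟨δ, hδ, hcont, fun c hc hcK ↦ key (F c) (hleaf c hc hcK)⟩

end Summit.FinalStateConjecture.FinalStateConjecture.Cruxes.LaminatedThreshold.Census

end
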